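import Summits.CriticalPhenomena.PercolationContinuityZ3.Theorems.PercNearOneGluingNoHeavyLowerTailKnQuestion8CoefficientwiseHarrisTwice
import Summits.CriticalPhenomena.PercolationContinuityZ3.Theorems.PercNearOneGluingNoHeavyLowerTailKnQuestion8CoefficientwiseNoCoreNbhd
import Summits.CriticalPhenomena.PercolationContinuityZ3.Theorems.PercNearOneGluingNoHeavyLowerTailKnQuestion8CoefficientwiseNoCoreDegTwo
import Summits.CriticalPhenomena.PercolationContinuityZ3.Theorems.PercNearOneGluingNoHeavyLowerTailKnQuestion8CoefficientwiseNoCoreAdjPoint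
import HarnessLib

/-!
# A pendant POINT transfers to its anchor: `Q_mix(p,q)[1_u, g] = Q_mix^{G−u}(p,q)[1_t, g]` for a leaf `u` hanging at `t` — prim-lf-2 gen 50

Support file (`--supports stmt-CriticalPhenomena-4575`, closed), prover `prim-lf-2` (gen 50).  No definitions, no named facts, no sorries; standard axioms.
Memo `prim-lf-2/CW-TWOSOURCE-gen50.md` §1.3 (coverage of CONJECTURE NO-CORE for the point pair); companion of `…CoefficientwiseQmixLeaf.lean` (leaf `p` or `q`).

Setting.  Finite multigraph `ends : ι → Sym2 V`, root `x`, `K(s) = openCluster (ends '' s) x`, `σ_v(s) = [v ∈ K s] − [v ∈ K sᶜ]`, `ĝ(s) = g(K s) − g(K sᶜ)`;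
`Q_mix(p,q)[1_u,g] = Σ_{s : ¬(p ∈ K s ∧ q ∈ K sᶜ)} σ_u ĝ` (`p = q = y` gives `NO-CORE(y)[1_u,g]`).  If the POINT `u ∉ {x,p,q}` is a leaf with the single edge `e = ut` and `g` ignores `u`,
then `[u ∈ K s] = [e red]·[t ∈ K′]`, `[u ∈ K sᶜ] = [e blue]·[t ∈ K′ᶜ-side]`, and summing out the colour of `e`:
* `qmix_leafPoint_eq` — `Q_mix(p,q)[1_u,g] = Q_mix^{G−u}(p,q)[1_t,g]` (exact; the sub-multigraph has edge type `{j // j ∉ {e}}`) — the coefficientwise form of the lineage's LEAF TRANSFER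
  (CW-GINIBRE-gen40 §2.2: an always-attached leaf `ℓ–z` has `[ℓ ∈ K] = [z ∈ K]`), here inside the two-point exclusion;
* `qmix_leafPoint_nonneg_of_anchor_fst` / `_snd` — anchor `t = p` or `t = q`: `Q_mix(p,q)[1_u,g] ≥ 0` (Harris twice, `qmix_nonneg_of_pointIndicator(_right)` on `G − u`);
* `noCore_leafPoint_adj_nonneg` — `p = q = y` and the anchor `t` adjacent to `y`: `NO-CORE(y)[1_u,g] ≥ 0` (gen 48's `noCore_adj_point_nonneg` on `G − u`): CONJECTURE NO-CORE for the
  point functions holds whenever the point is a leaf hanging at a neighbour of `y` (or at the other point, or at the root — then the sum is trivially `≥ 0` / `= 0`).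
Coverage (prim-lf-2 code/gen50/c/nccov50d.c): with the leaf-point transfer the Lean-settled share of the NO-CORE point instances `(G,y)` is 99.9 % at n = 6 (114 of 80 112 left, all of one
type: `deg y = 2`, both points adjacent to the root) and 99.7 % at n = 7, m ≤ 9 (4 344 of 1 999 128 left).
[cite: KozmaNitzan2024, Questions 8–9 (§5.5 p. 36) (context: the Question-8 pocket covariance programme)]
-/

namespace Summit.CriticalPhenomena.PercolationContinuityZ3.Theorems

open Finset Literature.Probability.Percolation

namespace Coefficientwise

variable {ι V : Type*} [Fintype ι] [DecidableEq ι] (ends : ι → Sym2 V) (x : V)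

omit [Fintype ι] in
/-- The power set of a singleton edge set (local copy; the tree's `powerset_singleton_eq` lives in a module not yet built on the farm).
[cite: KozmaNitzan2024, §5.5 (context only; bookkeeping)] -/
private theorem powerset_singleton_eq' (e : ι) : ({e} : Finset ι).powerset = {∅, {e}} := by
  ext s
  rw [Finset.mem_powerset, Finset.subset_singleton_iff, Finset.mem_insert, Finset.mem_singleton]

section leafpoint

variable {u t p q : V} {e : ι} (g : Set V → ℝ)

open Classical in
/-- **Leaf-point transfer.**  Let `u ∉ {x,p,q}` have exactly one edge `e`, with ends `{u,t}`, `t ≠ u`, and let `g` ignore `u`.  Then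
`Q_mix(p,q)[1_u,g] = Q_mix^{G−u}(p,q)[1_t,g]`, the right side over the cube of the multigraph with edge type `{j // j ∉ {e}}`.
[cite: KozmaNitzan2024, Questions 8–9 (§5.5 p. 36) (context)] -/
theorem qmix_leafPoint_eq (he : ends e = s(u, t)) (htu : t ≠ u) (hxu : x ≠ u) (hpu : p ≠ u) (hqu : q ≠ u) (hdeg : ∀ i, u ∈ ends i → i = e)
    (hgu : ∀ C : Set V, g (insert u C) = g C) :
    ∑ s ∈ univ.filter (fun s : Finset ι => ¬ (p ∈ openCluster (ends '' (↑s : Set ι)) x ∧ q ∈ openCluster (ends '' (↑(sᶜ) : Set ι)) x)),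
      ((if u ∈ openCluster (ends '' (↑s : Set ι)) x then (1 : ℝ) else 0) - (if u ∈ openCluster (ends '' (↑(sᶜ) : Set ι)) x then (1 : ℝ) else 0)) *
        (g (openCluster (ends '' (↑s : Set ι)) x) - g (openCluster (ends '' (↑(sᶜ) : Set ι)) x)) =
    ∑ r ∈ univ.filter (fun r : Finset {j : ι // j ∉ ({e} : Finset ι)} =>
        ¬ (p ∈ openCluster ((fun j : {j : ι // j ∉ ({e} : Finset ι)} => ends j.1) '' (↑r : Set {j : ι // j ∉ ({e} : Finset ι)})) x ∧
           q ∈ openCluster ((fun j : {j : ι // j ∉ ({e} : Finset ι)} => ends j.1) '' (↑(rᶜ) : Set {j : ι // j ∉ ({e} : Finset ι)})) x)),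
      ((if t ∈ openCluster ((fun j : {j : ι // j ∉ ({e} : Finset ι)} => ends j.1) '' (↑r : Set {j : ι // j ∉ ({e} : Finset ι)})) x then (1 : ℝ) else 0) -
          (if t ∈ openCluster ((fun j : {j : ι // j ∉ ({e} : Finset ι)} => ends j.1) '' (↑(rᶜ) : Set {j : ι // j ∉ ({e} : Finset ι)})) x then (1 : ℝ) else 0)) *
        (g (openCluster ((fun j : {j : ι // j ∉ ({e} : Finset ι)} => ends j.1) '' (↑r : Set {j : ι // j ∉ ({e} : Finset ι)})) x) -
          g (openCluster ((fun j : {j : ι // j ∉ ({e} : Finset ι)} => ends j.1) '' (↑(rᶜ) : Set {j : ι // j ∉ ({e} : Finset ι)})) x)) := by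
  classical
  set D : Finset ι := {e} with hD
  set Pr : ι → Prop := fun j => j ∉ D with hPr
  set K : Finset ι → Set V := fun s => openCluster (ends '' (↑s : Set ι)) x with hK
  set emb := Function.Embedding.subtype Pr with hemb
  set K' : Finset {j : ι // Pr j} → Set V := fun r => openCluster ((fun j : {j : ι // Pr j} => ends j.1) '' (↑r : Set {j : ι // Pr j})) x with hK'
  have hKT : ∀ r : Finset {j : ι // Pr j}, K' r = K (r.map emb) := by
    intro r
    simp only [hK', hK, Finset.coe_map, Set.image_image]
    rfl
  have hnoT : ∀ r : Finset {j : ι // Pr j}, ∀ i ∈ r.map emb, u ∉ ends i := by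
    intro r i hi hui
    obtain ⟨hP, _⟩ := (mem_map_subtype_iff Pr r i).mp hi
    have := hdeg i hui
    subst this
    exact hP (by simp [hD])
  have pend : ∀ r : Finset {j : ι // Pr j},
      (∀ v, v ≠ u → (v ∈ K (insert e (r.map emb)) ↔ v ∈ K' r)) ∧ (u ∈ K (insert e (r.map emb)) ↔ t ∈ K' r) ∧ u ∉ K' r := by
    intro r; rw [hKT r]; exact openCluster_insert_leafEdge ends x (r.map emb) he htu hxu (hnoT r)
  -- resolve the colour of `e`
  rw [Finset.sum_filter, Finset.sum_filter]
  rw [sum_cube_eq_sum_powerset_subcube D (fun s s' =>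
      if ¬ (p ∈ openCluster (ends '' (↑s : Set ι)) x ∧ q ∈ openCluster (ends '' (↑s' : Set ι)) x) then
        ((if u ∈ openCluster (ends '' (↑s : Set ι)) x then (1 : ℝ) else 0) - (if u ∈ openCluster (ends '' (↑s' : Set ι)) x then (1 : ℝ) else 0)) *
          (g (openCluster (ends '' (↑s : Set ι)) x) - g (openCluster (ends '' (↑s' : Set ι)) x)) else 0)]
  rw [show D.powerset = {∅, {e}} from powerset_singleton_eq' e, Finset.sum_pair (Finset.singleton_ne_empty e).symm]
  have h0 : D \ ∅ = {e} := by simp [hD]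
  have h1 : D \ {e} = ∅ := by simp [hD]
  simp only [h0, h1, Finset.union_empty]
  change ∑ r : Finset {j : ι // Pr j}, (if ¬ (p ∈ K (r.map emb) ∧ q ∈ K (rᶜ.map emb ∪ {e})) then
        ((if u ∈ K (r.map emb) then (1 : ℝ) else 0) - (if u ∈ K (rᶜ.map emb ∪ {e}) then (1 : ℝ) else 0)) * (g (K (r.map emb)) - g (K (rᶜ.map emb ∪ {e}))) else 0)
    + ∑ r : Finset {j : ι // Pr j}, (if ¬ (p ∈ K (r.map emb ∪ {e}) ∧ q ∈ K (rᶜ.map emb)) then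
        ((if u ∈ K (r.map emb ∪ {e}) then (1 : ℝ) else 0) - (if u ∈ K (rᶜ.map emb) then (1 : ℝ) else 0)) * (g (K (r.map emb ∪ {e})) - g (K (rᶜ.map emb))) else 0)
    = ∑ r : Finset {j : ι // Pr j}, (if ¬ (p ∈ K' r ∧ q ∈ K' rᶜ) then
        ((if t ∈ K' r then (1 : ℝ) else 0) - (if t ∈ K' rᶜ then (1 : ℝ) else 0)) * (g (K' r) - g (K' rᶜ)) else 0)
  have hins : ∀ r : Finset {j : ι // Pr j}, r.map emb ∪ {e} = insert e (r.map emb) := by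
    intro r; rw [Finset.union_comm, ← Finset.insert_eq]
  rw [← Finset.sum_add_distrib]
  refine Finset.sum_congr rfl fun r _ => ?_
  rw [hins r, hins rᶜ, ← hKT r, ← hKT rᶜ]
  obtain ⟨a1, b1, c1⟩ := pend r        -- e red: leaf facts for `insert e r⁺`
  obtain ⟨a2, b2, c2⟩ := pend rᶜ       -- e blue: leaf facts for `insert e (rᶜ)⁺`
  have hp1 : p ∈ K (insert e (r.map emb)) ↔ p ∈ K' r := a1 p hpu
  have hq2 : q ∈ K (insert e (rᶜ.map emb)) ↔ q ∈ K' rᶜ := a2 q hqu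
  have hu1 : u ∉ K' r := c1
  have hu2 : u ∉ K' rᶜ := c2
  rw [apply_eq_of_agree_off g hgu a1 c1, apply_eq_of_agree_off g hgu a2 c2]
  simp only [hp1, hq2, b1, b2, hu1, hu2, if_false]
  by_cases hc : ¬ (p ∈ K' r ∧ q ∈ K' rᶜ)
  · rw [if_pos hc, if_pos hc, if_pos hc]; ring
  · rw [if_neg hc, if_neg hc, if_neg hc]; ring

open Classical in
/-- **Leaf point hanging at `p`: `Q_mix(p,q)[1_u,g] ≥ 0`** (transfer to the anchor + Harris twice `qmix_nonneg_of_pointIndicator` on `G − u`).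
[cite: KozmaNitzan2024, Questions 8–9 (§5.5 p. 36) (context)] -/
theorem qmix_leafPoint_nonneg_of_anchor_fst (he : ends e = s(u, p)) (hxu : x ≠ u) (hpu : p ≠ u) (hqu : q ≠ u) (hdeg : ∀ i, u ∈ ends i → i = e)
    (hg : Monotone g) (hgu : ∀ C : Set V, g (insert u C) = g C) :
    0 ≤ ∑ s ∈ univ.filter (fun s : Finset ι => ¬ (p ∈ openCluster (ends '' (↑s : Set ι)) x ∧ q ∈ openCluster (ends '' (↑(sᶜ) : Set ι)) x)),
      ((if u ∈ openCluster (ends '' (↑s : Set ι)) x then (1 : ℝ) else 0) - (if u ∈ openCluster (ends '' (↑(sᶜ) : Set ι)) x then (1 : ℝ) else 0)) *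
        (g (openCluster (ends '' (↑s : Set ι)) x) - g (openCluster (ends '' (↑(sᶜ) : Set ι)) x)) := by
  rw [qmix_leafPoint_eq ends x g he hpu hxu hpu hqu hdeg hgu]
  exact qmix_nonneg_of_pointIndicator (fun j : {j : ι // j ∉ ({e} : Finset ι)} => ends j.1) x p q g hg

open Classical in
/-- **Leaf point hanging at `q`: `Q_mix(p,q)[1_u,g] ≥ 0`** (transfer + `qmix_nonneg_of_pointIndicator_right` on `G − u`).
[cite: KozmaNitzan2024, Questions 8–9 (§5.5 p. 36) (context)] -/
theorem qmix_leafPoint_nonneg_of_anchor_snd (he : ends e = s(u, q)) (hxu : x ≠ u) (hpu : p ≠ u) (hqu : q ≠ u) (hdeg : ∀ i, u ∈ ends i → i = e)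
    (hg : Monotone g) (hgu : ∀ C : Set V, g (insert u C) = g C) :
    0 ≤ ∑ s ∈ univ.filter (fun s : Finset ι => ¬ (p ∈ openCluster (ends '' (↑s : Set ι)) x ∧ q ∈ openCluster (ends '' (↑(sᶜ) : Set ι)) x)),
      ((if u ∈ openCluster (ends '' (↑s : Set ι)) x then (1 : ℝ) else 0) - (if u ∈ openCluster (ends '' (↑(sᶜ) : Set ι)) x then (1 : ℝ) else 0)) *
        (g (openCluster (ends '' (↑s : Set ι)) x) - g (openCluster (ends '' (↑(sᶜ) : Set ι)) x)) := by
  rw [qmix_leafPoint_eq ends x g he hqu hxu hpu hqu hdeg hgu]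
  exact qmix_nonneg_of_pointIndicator_right (fun j : {j : ι // j ∉ ({e} : Finset ι)} => ends j.1) x p q g hg

end leafpoint

section nocore

variable {u t y : V} {e e₁ : ι} (g : Set V → ℝ)

open Classical in
/-- **NO-CORE for a leaf point hanging at a neighbour of `y`.**  Let the point `u ∉ {x,y}` be a leaf with the single edge `e = ut` (`t ≠ u`), let `t` be adjacent to `y` through an edge
`e₁` (`t ≠ y`), and let the monotone `g` ignore `u`.  Then `0 ≤ NO-CORE(y)[1_u,g] = Σ_{s : ¬(y ∈ K s ∧ y ∈ K sᶜ)} ([u ∈ K s] − [u ∈ K sᶜ])(g(K s) − g(K sᶜ))`: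
transfer to the anchor (`qmix_leafPoint_eq` with `p = q = y`) and gen 48's `noCore_adj_point_nonneg` on `G − u` (where `e₁ ≠ e` survives).
[cite: KozmaNitzan2024, Questions 8–9 (§5.5 p. 36) (context)] -/
theorem noCore_leafPoint_adj_nonneg (he : ends e = s(u, t)) (htu : t ≠ u) (hxu : x ≠ u) (hyu : y ≠ u) (hdeg : ∀ i, u ∈ ends i → i = e)
    (he₁ : ends e₁ = s(y, t)) (hty : t ≠ y)
    (hg : Monotone g) (hgu : ∀ C : Set V, g (insert u C) = g C) :
    0 ≤ ∑ s ∈ univ.filter (fun s : Finset ι => ¬ (y ∈ openCluster (ends '' (↑s : Set ι)) x ∧ y ∈ openCluster (ends '' (↑(sᶜ) : Set ι)) x)),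
      ((if u ∈ openCluster (ends '' (↑s : Set ι)) x then (1 : ℝ) else 0) - (if u ∈ openCluster (ends '' (↑(sᶜ) : Set ι)) x then (1 : ℝ) else 0)) *
        (g (openCluster (ends '' (↑s : Set ι)) x) - g (openCluster (ends '' (↑(sᶜ) : Set ι)) x)) := by
  rw [qmix_leafPoint_eq ends x g he htu hxu hyu hyu hdeg hgu]
  -- the edge `e₁ = ty` is not the leaf edge `e = ut` (it would put `y ∈ {u,t}`)
  have hne : e₁ ∉ ({e} : Finset ι) := by
    rw [Finset.mem_singleton]
    intro h
    have : y ∈ ends e := by rw [← h, he₁]; exact Sym2.mem_mk_left _ _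
    rw [he, Sym2.mem_iff] at this
    rcases this with h | h
    · exact hyu h
    · exact hty h.symm
  have he₁' : (fun j : {j : ι // j ∉ ({e} : Finset ι)} => ends j.1) ⟨e₁, hne⟩ = s(y, t) := he₁
  exact noCore_adj_point_nonneg (fun j : {j : ι // j ∉ ({e} : Finset ι)} => ends j.1) x y t he₁' hty g hg

end nocore

end Coefficientwise

end Summit.CriticalPhenomena.PercolationContinuityZ3.Theorems
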